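import Summits.Ventures.CertifiedManyBodySolver.Certificates.HubbardSquare_transportClosure_Kit
import Literature.MathematicalPhysics.QuantumLattice.HubbardTTPrimeChemicalPotentialFloors
import HarnessLib

/-!
# Ventures/CertifiedManyBodySolver — Certificates/HubbardSquare_transportClosure_KitF.lean
# (hubbard-fast-reuse-5 g4, cell hubbard-fast, D-0154 (A) CERTIFICATE REUSE: the TRANSPORT-CLOSURE kit, part 6 = OFF-AXIS («fan» /
# triangle) chords for SCATTERED row sheets; parts 1/2 = hubbard-fast-reuse-1's `…_Kit.lean` / `…_KitLaws.lean`, part 3 = `…_KitT.lean`,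
# part 5 = `…_KitS.lean`)

The ground-state energy density `e₀(t, s, U, n)` is jointly CONCAVE in the couplings `(s, U) = (t'/t, U/t)` on `U ≥ 0` at fixed
filling (`energyDensityTT'_ge_convexComb`, `energyDensityTT'_ge_sum_lowerBounds`, [Israel 1979, Thm. I.3.4]). Parts 2/3 read that
law ALONG the coordinate axes (`tc_mlFloor_Uchord`: two `U`-slices at a common `t'`-range; `tc_mlFloor_tchord`: two `t'`-slices at a
common `U`-range). A producer ROW enters the kit as an `n`-SHEET = a `μ`-floor `(c, μ)` at ONE anchor `(s₀, U₀)`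
(`c + μ·m ≤ e₀(t, s₀, U₀, m)` for every `0 ≤ m < 2`, part 5); two rows at anchors sharing neither `t'` nor `U` have no common axis,
and the axis laws reach one from the other only through the flat `U`-carry (`gcFloor_mono_U`) or the `t'`-drift (slope loss
`4|Δt'|`). This file reads the SAME concavity law along OBLIQUE segments:
* `tc_mlFloor_fanUr` / `tc_mlFloor_fanUl` — FAN from a sheet apex `(s₀, U₀)` to a bilinear floor on a `U`-FACE `U = U₁` (the
  `tc_sliceU_floor` shape `β₀ + β₁s + β₂n + β₃sn ≤ e(t, s, U₁, n)` on `[s₁, s₂] × [n₁, n₂]`) lying to the RIGHT (`U₀ < Ua ≤ θ0 ≤ Ub ≤ U₁`)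
  resp. LEFT (`U₁ ≤ Ua ≤ θ0 ≤ Ub < U₀`) of the target cell: the segment from the apex through `(θ0, θ1)` meets the face at the hopping
  `s_B = s₀ + (θ1 − s₀)(U₁ − U₀)/(θ0 − U₀)`, which must lie in `[s₁, s₂]` (an AFFINE condition in `(θ0, θ1)`: four corner checks for
  each side), and the chord value `((U₁ − θ0)(c + μθ2) + (θ0 − U₀)·B(s_B, θ2))/(U₁ − U₀)` is EXACTLY trilinear in `θ`; a literal
  8-coefficient form below it at the eight vertices of the cell is a floor on the cell (the difference is trilinear, vertex rule).
* `tc_mlFloor_fanTa` / `tc_mlFloor_fanTb` — FAN from a sheet apex to a bilinear floor on a `t'`-FACE `t' = s₁` (the `tc_sliceT_floor`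
  shape `β₀ + β₁U + β₂n + β₃Un ≤ e(t, s₁, U, n)` on `[p, q] × [n₁, n₂]`) ABOVE (`s₀ < sa ≤ θ1 ≤ sb ≤ s₁`) resp. BELOW
  (`s₁ ≤ sa ≤ θ1 ≤ sb < s₀`) the cell; the segment meets the face at `U_B = U₀ + (θ0 − U₀)(s₁ − s₀)/(θ1 − s₀) ∈ [p, q]` (four + four
  corner checks); output exactly trilinear, eight vertex checks.
* `tc_mlFloor_tri` — TRIANGLE of three sheets at anchors `(sᵢ, Uᵢ)` (positively oriented: `D = (U₂−U₁)(s₃−s₁) − (U₃−U₁)(s₂−s₁) > 0`):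
  on every cell whose four `(θ0, θ1)`-corners have non-negative barycentric numerators (twelve affine checks) the barycentric
  combination `Σ Nᵢ(θ0,θ1)(cᵢ + μᵢθ2)/D` is an exact trilinear floor; eight vertex checks against a literal form.
* `tc_sheet_monoU` — a sheet at `(s₀, U₀)` is a sheet at every `(s₀, U₀')`, `U₀' ≥ U₀` (`gcFloor_mono_U`): anchors may be SHIFTED UP
  in `U` before entering a fan / triangle, so the `U`-shadow of the hull of the anchors is covered with the same three laws.
HONEST FRAMING: bookkeeping adapters; they certify nothing by themselves; every consumer word inherits exactly the sheet / word
hypotheses it cites (producer-certified CANDIDATE rows until replayed); no number of record; not a phase word; no summit statement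
is proved here; not a superconductivity verdict.
-/

namespace Summit.Ventures.CertifiedManyBodySolver.Certificates

open Literature.MathematicalPhysics.QuantumLattice
open Literature.MathematicalPhysics.QuantumLattice.ThermodynamicLimit
open Set

/-! ### §0 Moving a sheet's anchor up in `U` -/

/-- **Sheet ⇒ sheet at a larger coupling.** A `μ`-floor `(c, μ)` at `(s₀, U₀)`, `U₀ ≥ 0`, is a `μ`-floor at `(s₀, U₀')` for every
`U₀' ≥ U₀` (`gcFloor_mono_U`): the anchors of the fan / triangle laws below may be shifted to the right before use.
[cite: Ruelle1969, §3.4] -/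
theorem tc_sheet_monoU (t : ℝ) {s₀ U₀ U₀' c μ : ℝ}
    (hc : ∀ m : ℝ, 0 ≤ m → m < 2 → c + μ * m ≤ energyDensityTT' t s₀ U₀ m)
    (hU₀ : 0 ≤ U₀) (hle : U₀ ≤ U₀') :
    ∀ m : ℝ, 0 ≤ m → m < 2 → c + μ * m ≤ energyDensityTT' t s₀ U₀' m :=
  fun _ hm0 hm2 => gcFloor_mono_U t s₀ hU₀ hle hc hm0 hm2


/-! ### §1 Fans from a sheet apex to a `U`-face -/

/-- **FAN FLOOR, apex left / `U`-face right** (joint concavity of `e₀` in `(t', U)` along the oblique segment from the sheet anchor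
`(s₀, U₀)` through the target point to the face `U = U₁`): a `μ`-floor `(c, μ)` at `(s₀, U₀)` (`U₀ ≥ 0`) and a bilinear floor
`β₀ + β₁s + β₂n + β₃sn ≤ e(t, s, U₁, n)` on `[s₁, s₂] × [n₁, n₂]` give, on every cell `[Ua, Ub] × [sa, sb] × [n₁, n₂]` with
`U₀ < Ua`, `Ub ≤ U₁` whose back-projected hoppings `s₀ + (θ1 − s₀)(U₁ − U₀)/(θ0 − U₀)` stay in `[s₁, s₂]` (corner checks `w`, `w'`),
`(U₁ − U₀)·e(θ) ≥ (U₁ − θ0)(c + μθ2) + (θ0 − U₀)(β₀ + β₂θ2) + (β₁ + β₃θ2)(s₀(θ0 − U₀) + (θ1 − s₀)(U₁ − U₀))`; a literal trilinear form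
below the right-hand side at the eight vertices is a floor on the cell. [cite: Israel1979, Thm. I.3.4] -/
theorem tc_mlFloor_fanUr (t : ℝ) {s₀ U₀ c μ U₁ s₁ s₂ Ua Ub sa sb n₁ n₂ β₀ β₁ β₂ β₃
    c₀ c₁ c₂ c₃ c₄ c₅ c₆ c₇ : ℝ}
    (hc : ∀ m : ℝ, 0 ≤ m → m < 2 → c + μ * m ≤ energyDensityTT' t s₀ U₀ m)
    (hU₀ : 0 ≤ U₀) (hUa : U₀ < Ua) (hUb : Ub ≤ U₁) (hn₁ : 0 ≤ n₁) (hn₂ : n₂ < 2)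
    (hB : ∀ s n : ℝ, s₁ ≤ s → s ≤ s₂ → n₁ ≤ n → n ≤ n₂ →
      β₀ + β₁ * s + β₂ * n + β₃ * s * n ≤ energyDensityTT' t s U₁ n)
    (w₁₁ : s₁ * (Ua - U₀) ≤ s₀ * (Ua - U₀) + (sa - s₀) * (U₁ - U₀))
    (w₁₁' : s₀ * (Ua - U₀) + (sa - s₀) * (U₁ - U₀) ≤ s₂ * (Ua - U₀))
    (w₁₂ : s₁ * (Ua - U₀) ≤ s₀ * (Ua - U₀) + (sb - s₀) * (U₁ - U₀))
    (w₁₂' : s₀ * (Ua - U₀) + (sb - s₀) * (U₁ - U₀) ≤ s₂ * (Ua - U₀))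
    (w₂₁ : s₁ * (Ub - U₀) ≤ s₀ * (Ub - U₀) + (sa - s₀) * (U₁ - U₀))
    (w₂₁' : s₀ * (Ub - U₀) + (sa - s₀) * (U₁ - U₀) ≤ s₂ * (Ub - U₀))
    (w₂₂ : s₁ * (Ub - U₀) ≤ s₀ * (Ub - U₀) + (sb - s₀) * (U₁ - U₀))
    (w₂₂' : s₀ * (Ub - U₀) + (sb - s₀) * (U₁ - U₀) ≤ s₂ * (Ub - U₀))
    (v₁₁₁ : (c₀ + c₁ * Ua + c₂ * sa + c₃ * n₁ + c₄ * Ua * sa + c₅ * Ua * n₁ + c₆ * sa * n₁ + c₇ * Ua * sa * n₁) * (U₁ - U₀) ≤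
      (U₁ - Ua) * (c + μ * n₁) + (Ua - U₀) * (β₀ + β₂ * n₁) + (β₁ + β₃ * n₁) * (s₀ * (Ua - U₀) + (sa - s₀) * (U₁ - U₀)))
    (v₁₁₂ : (c₀ + c₁ * Ua + c₂ * sa + c₃ * n₂ + c₄ * Ua * sa + c₅ * Ua * n₂ + c₆ * sa * n₂ + c₇ * Ua * sa * n₂) * (U₁ - U₀) ≤
      (U₁ - Ua) * (c + μ * n₂) + (Ua - U₀) * (β₀ + β₂ * n₂) + (β₁ + β₃ * n₂) * (s₀ * (Ua - U₀) + (sa - s₀) * (U₁ - U₀)))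
    (v₁₂₁ : (c₀ + c₁ * Ua + c₂ * sb + c₃ * n₁ + c₄ * Ua * sb + c₅ * Ua * n₁ + c₆ * sb * n₁ + c₇ * Ua * sb * n₁) * (U₁ - U₀) ≤
      (U₁ - Ua) * (c + μ * n₁) + (Ua - U₀) * (β₀ + β₂ * n₁) + (β₁ + β₃ * n₁) * (s₀ * (Ua - U₀) + (sb - s₀) * (U₁ - U₀)))
    (v₁₂₂ : (c₀ + c₁ * Ua + c₂ * sb + c₃ * n₂ + c₄ * Ua * sb + c₅ * Ua * n₂ + c₆ * sb * n₂ + c₇ * Ua * sb * n₂) * (U₁ - U₀) ≤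
      (U₁ - Ua) * (c + μ * n₂) + (Ua - U₀) * (β₀ + β₂ * n₂) + (β₁ + β₃ * n₂) * (s₀ * (Ua - U₀) + (sb - s₀) * (U₁ - U₀)))
    (v₂₁₁ : (c₀ + c₁ * Ub + c₂ * sa + c₃ * n₁ + c₄ * Ub * sa + c₅ * Ub * n₁ + c₆ * sa * n₁ + c₇ * Ub * sa * n₁) * (U₁ - U₀) ≤
      (U₁ - Ub) * (c + μ * n₁) + (Ub - U₀) * (β₀ + β₂ * n₁) + (β₁ + β₃ * n₁) * (s₀ * (Ub - U₀) + (sa - s₀) * (U₁ - U₀)))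
    (v₂₁₂ : (c₀ + c₁ * Ub + c₂ * sa + c₃ * n₂ + c₄ * Ub * sa + c₅ * Ub * n₂ + c₆ * sa * n₂ + c₇ * Ub * sa * n₂) * (U₁ - U₀) ≤
      (U₁ - Ub) * (c + μ * n₂) + (Ub - U₀) * (β₀ + β₂ * n₂) + (β₁ + β₃ * n₂) * (s₀ * (Ub - U₀) + (sa - s₀) * (U₁ - U₀)))
    (v₂₂₁ : (c₀ + c₁ * Ub + c₂ * sb + c₃ * n₁ + c₄ * Ub * sb + c₅ * Ub * n₁ + c₆ * sb * n₁ + c₇ * Ub * sb * n₁) * (U₁ - U₀) ≤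
      (U₁ - Ub) * (c + μ * n₁) + (Ub - U₀) * (β₀ + β₂ * n₁) + (β₁ + β₃ * n₁) * (s₀ * (Ub - U₀) + (sb - s₀) * (U₁ - U₀)))
    (v₂₂₂ : (c₀ + c₁ * Ub + c₂ * sb + c₃ * n₂ + c₄ * Ub * sb + c₅ * Ub * n₂ + c₆ * sb * n₂ + c₇ * Ub * sb * n₂) * (U₁ - U₀) ≤
      (U₁ - Ub) * (c + μ * n₂) + (Ub - U₀) * (β₀ + β₂ * n₂) + (β₁ + β₃ * n₂) * (s₀ * (Ub - U₀) + (sb - s₀) * (U₁ - U₀))) :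
    ∀ θ ∈ Set.Icc (![Ua, sa, n₁] : Fin 3 → ℝ) ![Ub, sb, n₂],
      c₀ + c₁ * θ 0 + c₂ * θ 1 + c₃ * θ 2 + c₄ * θ 0 * θ 1 + c₅ * θ 0 * θ 2 + c₆ * θ 1 * θ 2 +
        c₇ * θ 0 * θ 1 * θ 2 ≤ energyDensityTT' t (θ 1) (θ 0) (θ 2) := by
  intro θ hθ
  obtain ⟨⟨k1, k2⟩, ⟨k3, k4⟩, ⟨k5, k6⟩⟩ := mem_Icc_vec3_iff.1 hθ
  have hn0 : 0 ≤ θ 2 := hn₁.trans k5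
  have hn2 : θ 2 < 2 := lt_of_le_of_lt k6 hn₂
  have hD : 0 < U₁ - U₀ := by linarith
  have hD0 : U₁ - U₀ ≠ 0 := hD.ne'
  have hd : 0 < θ 0 - U₀ := by linarith
  have hU₁ : 0 ≤ U₁ := by linarith
  -- cone membership: the back-projected hopping lies in the face's `t'`-range
  have hlo : 0 ≤ (s₁ * U₀ - s₀ * U₁) + (s₀ - s₁) * θ 0 + (U₁ - U₀) * θ 1 + 0 * θ 0 * θ 1 :=
    bilinear_nonneg_on_rect k1 k2 k3 k4 (by linear_combination w₁₁) (by linear_combination w₁₂)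
      (by linear_combination w₂₁) (by linear_combination w₂₂)
  have hhi : 0 ≤ (s₀ * U₁ - s₂ * U₀) + (s₂ - s₀) * θ 0 + (-(U₁ - U₀)) * θ 1 + 0 * θ 0 * θ 1 :=
    bilinear_nonneg_on_rect k1 k2 k3 k4 (by linear_combination w₁₁') (by linear_combination w₁₂')
      (by linear_combination w₂₁') (by linear_combination w₂₂')
  set sB : ℝ := s₀ + (θ 1 - s₀) * (U₁ - U₀) / (θ 0 - U₀) with hsB_def
  have hdsB : (θ 0 - U₀) * sB = s₀ * (θ 0 - U₀) + (θ 1 - s₀) * (U₁ - U₀) := by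
    rw [hsB_def]; field_simp
  have hsB₁ : s₁ ≤ sB := by
    have h1 : s₁ * (θ 0 - U₀) ≤ sB * (θ 0 - U₀) := by linear_combination hlo - hdsB
    exact le_of_mul_le_mul_right h1 hd
  have hsB₂ : sB ≤ s₂ := by
    have h1 : sB * (θ 0 - U₀) ≤ s₂ * (θ 0 - U₀) := by linear_combination hhi + hdsB
    exact le_of_mul_le_mul_right h1 hd
  have hA' := hc (θ 2) hn0 hn2
  have hB' := hB sB (θ 2) hsB₁ hsB₂ k5 k6
  set a : ℝ := (U₁ - θ 0) / (U₁ - U₀) with ha_def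
  set b : ℝ := (θ 0 - U₀) / (U₁ - U₀) with hb_def
  have ha0 : 0 ≤ a := div_nonneg (by linarith) hD.le
  have hb0 : 0 ≤ b := div_nonneg (by linarith) hD.le
  have hDa : (U₁ - U₀) * a = U₁ - θ 0 := by rw [ha_def]; field_simp
  have hDb : (U₁ - U₀) * b = θ 0 - U₀ := by rw [hb_def]; field_simp
  have hab : a + b = 1 := by
    have h1 : (U₁ - U₀) * (a + b) = (U₁ - U₀) * 1 := by rw [mul_add, hDa, hDb]; ring
    exact mul_left_cancel₀ hD0 h1
  have hcc := energyDensityTT'_ge_convexComb t hn0 hn2 hU₀ hU₁ ha0 hb0 hab hA' hB'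
  have eu : a * U₀ + b * U₁ = θ 0 := by
    have h1 : (U₁ - U₀) * (a * U₀ + b * U₁) = (U₁ - U₀) * θ 0 := by
      have e1 : (U₁ - U₀) * (a * U₀ + b * U₁) = ((U₁ - U₀) * a) * U₀ + ((U₁ - U₀) * b) * U₁ := by ring
      rw [e1, hDa, hDb]; ring
    exact mul_left_cancel₀ hD0 h1
  have es : a * s₀ + b * sB = θ 1 := by
    have h1 : (U₁ - U₀) * (a * s₀ + b * sB) = (U₁ - U₀) * θ 1 := by
      have e1 : (U₁ - U₀) * (a * s₀ + b * sB) = ((U₁ - U₀) * a) * s₀ + ((U₁ - U₀) * b) * sB := by ring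
      rw [e1, hDa, hDb]; linear_combination hdsB
    exact mul_left_cancel₀ hD0 h1
  rw [es, eu] at hcc
  have h1 : (U₁ - θ 0) * (c + μ * θ 2) + (θ 0 - U₀) * (β₀ + β₂ * θ 2) + (β₁ + β₃ * θ 2) * (s₀ * (θ 0 - U₀) + (θ 1 - s₀) * (U₁ - U₀)) ≤
      (U₁ - U₀) * energyDensityTT' t (θ 1) (θ 0) (θ 2) := by
    have h2 := mul_le_mul_of_nonneg_left hcc hD.le
    have e2 : (U₁ - U₀) * (a * (c + μ * θ 2) + b * (β₀ + β₁ * sB + β₂ * θ 2 + β₃ * sB * θ 2)) = ((U₁ - U₀) * a) * (c + μ * θ 2) + ((U₁ - U₀) * b) * (β₀ + β₂ * θ 2) + (β₁ + β₃ * θ 2) * (((U₁ - U₀) * b) * sB) := by ring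
    rw [e2, hDa, hDb, hdsB] at h2
    linear_combination h2
  have hv := trilinear_nonneg_on_Icc₃ (a₀ := Ua) (a₁ := sa) (a₂ := n₁) (b₀ := Ub) (b₁ := sb) (b₂ := n₂)
    (c₀ := U₁ * c - U₀ * β₀ - β₁ * s₀ * U₁ - (U₁ - U₀) * c₀) (c₁ := -c + β₀ + β₁ * s₀ - (U₁ - U₀) * c₁)
    (c₂ := β₁ * (U₁ - U₀) - (U₁ - U₀) * c₂) (c₃ := U₁ * μ - U₀ * β₂ - β₃ * s₀ * U₁ - (U₁ - U₀) * c₃)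
    (c₄ := 0 - (U₁ - U₀) * c₄) (c₅ := -μ + β₂ + β₃ * s₀ - (U₁ - U₀) * c₅)
    (c₆ := β₃ * (U₁ - U₀) - (U₁ - U₀) * c₆) (c₇ := 0 - (U₁ - U₀) * c₇)
    (by linear_combination v₁₁₁) (by linear_combination v₁₁₂) (by linear_combination v₁₂₁)
    (by linear_combination v₁₂₂) (by linear_combination v₂₁₁) (by linear_combination v₂₁₂)
    (by linear_combination v₂₂₁) (by linear_combination v₂₂₂) θ hθ
  have h3 : (U₁ - U₀) * (c₀ + c₁ * θ 0 + c₂ * θ 1 + c₃ * θ 2 + c₄ * θ 0 * θ 1 + c₅ * θ 0 * θ 2 +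
      c₆ * θ 1 * θ 2 + c₇ * θ 0 * θ 1 * θ 2) ≤ (U₁ - U₀) * energyDensityTT' t (θ 1) (θ 0) (θ 2) := by
    linear_combination h1 + hv
  exact le_of_mul_le_mul_left h3 hD

/-- **FAN FLOOR, apex right / `U`-face left** (the mirror statement of `tc_mlFloor_fanUr`): a `μ`-floor `(c, μ)` at `(s₀, U₀)`
and a bilinear floor `β₀ + β₁s + β₂n + β₃sn ≤ e(t, s, U₁, n)` on `[s₁, s₂] × [n₁, n₂]` at a face `U₁ ≥ 0` LEFT of the cell
(`U₁ ≤ Ua`, `Ub < U₀`) give, when the back-projected hoppings `s₀ + (θ1 − s₀)(U₀ − U₁)/(U₀ − θ0)` stay in `[s₁, s₂]`,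
`(U₀ − U₁)·e(θ) ≥ (θ0 − U₁)(c + μθ2) + (U₀ − θ0)(β₀ + β₂θ2) + (β₁ + β₃θ2)(s₀(U₀ − θ0) + (θ1 − s₀)(U₀ − U₁))`; eight vertex checks
turn a literal trilinear form below it into a floor on the cell. [cite: Israel1979, Thm. I.3.4] -/
theorem tc_mlFloor_fanUl (t : ℝ) {s₀ U₀ c μ U₁ s₁ s₂ Ua Ub sa sb n₁ n₂ β₀ β₁ β₂ β₃
    c₀ c₁ c₂ c₃ c₄ c₅ c₆ c₇ : ℝ}
    (hc : ∀ m : ℝ, 0 ≤ m → m < 2 → c + μ * m ≤ energyDensityTT' t s₀ U₀ m)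
    (hU₁ : 0 ≤ U₁) (hUa : U₁ ≤ Ua) (hUb : Ub < U₀) (hn₁ : 0 ≤ n₁) (hn₂ : n₂ < 2)
    (hB : ∀ s n : ℝ, s₁ ≤ s → s ≤ s₂ → n₁ ≤ n → n ≤ n₂ →
      β₀ + β₁ * s + β₂ * n + β₃ * s * n ≤ energyDensityTT' t s U₁ n)
    (w₁₁ : s₁ * (U₀ - Ua) ≤ s₀ * (U₀ - Ua) + (sa - s₀) * (U₀ - U₁))
    (w₁₁' : s₀ * (U₀ - Ua) + (sa - s₀) * (U₀ - U₁) ≤ s₂ * (U₀ - Ua))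
    (w₁₂ : s₁ * (U₀ - Ua) ≤ s₀ * (U₀ - Ua) + (sb - s₀) * (U₀ - U₁))
    (w₁₂' : s₀ * (U₀ - Ua) + (sb - s₀) * (U₀ - U₁) ≤ s₂ * (U₀ - Ua))
    (w₂₁ : s₁ * (U₀ - Ub) ≤ s₀ * (U₀ - Ub) + (sa - s₀) * (U₀ - U₁))
    (w₂₁' : s₀ * (U₀ - Ub) + (sa - s₀) * (U₀ - U₁) ≤ s₂ * (U₀ - Ub))
    (w₂₂ : s₁ * (U₀ - Ub) ≤ s₀ * (U₀ - Ub) + (sb - s₀) * (U₀ - U₁))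
    (w₂₂' : s₀ * (U₀ - Ub) + (sb - s₀) * (U₀ - U₁) ≤ s₂ * (U₀ - Ub))
    (v₁₁₁ : (c₀ + c₁ * Ua + c₂ * sa + c₃ * n₁ + c₄ * Ua * sa + c₅ * Ua * n₁ + c₆ * sa * n₁ + c₇ * Ua * sa * n₁) * (U₀ - U₁) ≤
      (Ua - U₁) * (c + μ * n₁) + (U₀ - Ua) * (β₀ + β₂ * n₁) + (β₁ + β₃ * n₁) * (s₀ * (U₀ - Ua) + (sa - s₀) * (U₀ - U₁)))
    (v₁₁₂ : (c₀ + c₁ * Ua + c₂ * sa + c₃ * n₂ + c₄ * Ua * sa + c₅ * Ua * n₂ + c₆ * sa * n₂ + c₇ * Ua * sa * n₂) * (U₀ - U₁) ≤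
      (Ua - U₁) * (c + μ * n₂) + (U₀ - Ua) * (β₀ + β₂ * n₂) + (β₁ + β₃ * n₂) * (s₀ * (U₀ - Ua) + (sa - s₀) * (U₀ - U₁)))
    (v₁₂₁ : (c₀ + c₁ * Ua + c₂ * sb + c₃ * n₁ + c₄ * Ua * sb + c₅ * Ua * n₁ + c₆ * sb * n₁ + c₇ * Ua * sb * n₁) * (U₀ - U₁) ≤
      (Ua - U₁) * (c + μ * n₁) + (U₀ - Ua) * (β₀ + β₂ * n₁) + (β₁ + β₃ * n₁) * (s₀ * (U₀ - Ua) + (sb - s₀) * (U₀ - U₁)))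
    (v₁₂₂ : (c₀ + c₁ * Ua + c₂ * sb + c₃ * n₂ + c₄ * Ua * sb + c₅ * Ua * n₂ + c₆ * sb * n₂ + c₇ * Ua * sb * n₂) * (U₀ - U₁) ≤
      (Ua - U₁) * (c + μ * n₂) + (U₀ - Ua) * (β₀ + β₂ * n₂) + (β₁ + β₃ * n₂) * (s₀ * (U₀ - Ua) + (sb - s₀) * (U₀ - U₁)))
    (v₂₁₁ : (c₀ + c₁ * Ub + c₂ * sa + c₃ * n₁ + c₄ * Ub * sa + c₅ * Ub * n₁ + c₆ * sa * n₁ + c₇ * Ub * sa * n₁) * (U₀ - U₁) ≤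
      (Ub - U₁) * (c + μ * n₁) + (U₀ - Ub) * (β₀ + β₂ * n₁) + (β₁ + β₃ * n₁) * (s₀ * (U₀ - Ub) + (sa - s₀) * (U₀ - U₁)))
    (v₂₁₂ : (c₀ + c₁ * Ub + c₂ * sa + c₃ * n₂ + c₄ * Ub * sa + c₅ * Ub * n₂ + c₆ * sa * n₂ + c₇ * Ub * sa * n₂) * (U₀ - U₁) ≤
      (Ub - U₁) * (c + μ * n₂) + (U₀ - Ub) * (β₀ + β₂ * n₂) + (β₁ + β₃ * n₂) * (s₀ * (U₀ - Ub) + (sa - s₀) * (U₀ - U₁)))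
    (v₂₂₁ : (c₀ + c₁ * Ub + c₂ * sb + c₃ * n₁ + c₄ * Ub * sb + c₅ * Ub * n₁ + c₆ * sb * n₁ + c₇ * Ub * sb * n₁) * (U₀ - U₁) ≤
      (Ub - U₁) * (c + μ * n₁) + (U₀ - Ub) * (β₀ + β₂ * n₁) + (β₁ + β₃ * n₁) * (s₀ * (U₀ - Ub) + (sb - s₀) * (U₀ - U₁)))
    (v₂₂₂ : (c₀ + c₁ * Ub + c₂ * sb + c₃ * n₂ + c₄ * Ub * sb + c₅ * Ub * n₂ + c₆ * sb * n₂ + c₇ * Ub * sb * n₂) * (U₀ - U₁) ≤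
      (Ub - U₁) * (c + μ * n₂) + (U₀ - Ub) * (β₀ + β₂ * n₂) + (β₁ + β₃ * n₂) * (s₀ * (U₀ - Ub) + (sb - s₀) * (U₀ - U₁))) :
    ∀ θ ∈ Set.Icc (![Ua, sa, n₁] : Fin 3 → ℝ) ![Ub, sb, n₂],
      c₀ + c₁ * θ 0 + c₂ * θ 1 + c₃ * θ 2 + c₄ * θ 0 * θ 1 + c₅ * θ 0 * θ 2 + c₆ * θ 1 * θ 2 +
        c₇ * θ 0 * θ 1 * θ 2 ≤ energyDensityTT' t (θ 1) (θ 0) (θ 2) := by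
  intro θ hθ
  obtain ⟨⟨k1, k2⟩, ⟨k3, k4⟩, ⟨k5, k6⟩⟩ := mem_Icc_vec3_iff.1 hθ
  have hn0 : 0 ≤ θ 2 := hn₁.trans k5
  have hn2 : θ 2 < 2 := lt_of_le_of_lt k6 hn₂
  have hD : 0 < U₀ - U₁ := by linarith
  have hD0 : U₀ - U₁ ≠ 0 := hD.ne'
  have hd : 0 < U₀ - θ 0 := by linarith
  have hU₀ : 0 ≤ U₀ := by linarith
  -- cone membership: the back-projected hopping lies in the face's `t'`-range
  have hlo : 0 ≤ (s₀ * U₁ - s₁ * U₀) + (s₁ - s₀) * θ 0 + (U₀ - U₁) * θ 1 + 0 * θ 0 * θ 1 :=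
    bilinear_nonneg_on_rect k1 k2 k3 k4 (by linear_combination w₁₁) (by linear_combination w₁₂)
      (by linear_combination w₂₁) (by linear_combination w₂₂)
  have hhi : 0 ≤ (s₂ * U₀ - s₀ * U₁) + (s₀ - s₂) * θ 0 + (-(U₀ - U₁)) * θ 1 + 0 * θ 0 * θ 1 :=
    bilinear_nonneg_on_rect k1 k2 k3 k4 (by linear_combination w₁₁') (by linear_combination w₁₂')
      (by linear_combination w₂₁') (by linear_combination w₂₂')
  set sB : ℝ := s₀ + (θ 1 - s₀) * (U₀ - U₁) / (U₀ - θ 0) with hsB_def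
  have hdsB : (U₀ - θ 0) * sB = s₀ * (U₀ - θ 0) + (θ 1 - s₀) * (U₀ - U₁) := by
    rw [hsB_def]; field_simp
  have hsB₁ : s₁ ≤ sB := by
    have h1 : s₁ * (U₀ - θ 0) ≤ sB * (U₀ - θ 0) := by linear_combination hlo - hdsB
    exact le_of_mul_le_mul_right h1 hd
  have hsB₂ : sB ≤ s₂ := by
    have h1 : sB * (U₀ - θ 0) ≤ s₂ * (U₀ - θ 0) := by linear_combination hhi + hdsB
    exact le_of_mul_le_mul_right h1 hd
  have hA' := hc (θ 2) hn0 hn2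
  have hB' := hB sB (θ 2) hsB₁ hsB₂ k5 k6
  set a : ℝ := (θ 0 - U₁) / (U₀ - U₁) with ha_def
  set b : ℝ := (U₀ - θ 0) / (U₀ - U₁) with hb_def
  have ha0 : 0 ≤ a := div_nonneg (by linarith) hD.le
  have hb0 : 0 ≤ b := div_nonneg (by linarith) hD.le
  have hDa : (U₀ - U₁) * a = θ 0 - U₁ := by rw [ha_def]; field_simp
  have hDb : (U₀ - U₁) * b = U₀ - θ 0 := by rw [hb_def]; field_simp
  have hab : a + b = 1 := by
    have h1 : (U₀ - U₁) * (a + b) = (U₀ - U₁) * 1 := by rw [mul_add, hDa, hDb]; ring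
    exact mul_left_cancel₀ hD0 h1
  have hcc := energyDensityTT'_ge_convexComb t hn0 hn2 hU₀ hU₁ ha0 hb0 hab hA' hB'
  have eu : a * U₀ + b * U₁ = θ 0 := by
    have h1 : (U₀ - U₁) * (a * U₀ + b * U₁) = (U₀ - U₁) * θ 0 := by
      have e1 : (U₀ - U₁) * (a * U₀ + b * U₁) = ((U₀ - U₁) * a) * U₀ + ((U₀ - U₁) * b) * U₁ := by ring
      rw [e1, hDa, hDb]; ring
    exact mul_left_cancel₀ hD0 h1
  have es : a * s₀ + b * sB = θ 1 := by
    have h1 : (U₀ - U₁) * (a * s₀ + b * sB) = (U₀ - U₁) * θ 1 := by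
      have e1 : (U₀ - U₁) * (a * s₀ + b * sB) = ((U₀ - U₁) * a) * s₀ + ((U₀ - U₁) * b) * sB := by ring
      rw [e1, hDa, hDb]; linear_combination hdsB
    exact mul_left_cancel₀ hD0 h1
  rw [es, eu] at hcc
  have h1 : (θ 0 - U₁) * (c + μ * θ 2) + (U₀ - θ 0) * (β₀ + β₂ * θ 2) + (β₁ + β₃ * θ 2) * (s₀ * (U₀ - θ 0) + (θ 1 - s₀) * (U₀ - U₁)) ≤
      (U₀ - U₁) * energyDensityTT' t (θ 1) (θ 0) (θ 2) := by
    have h2 := mul_le_mul_of_nonneg_left hcc hD.le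
    have e2 : (U₀ - U₁) * (a * (c + μ * θ 2) + b * (β₀ + β₁ * sB + β₂ * θ 2 + β₃ * sB * θ 2)) = ((U₀ - U₁) * a) * (c + μ * θ 2) + ((U₀ - U₁) * b) * (β₀ + β₂ * θ 2) + (β₁ + β₃ * θ 2) * (((U₀ - U₁) * b) * sB) := by ring
    rw [e2, hDa, hDb, hdsB] at h2
    linear_combination h2
  have hv := trilinear_nonneg_on_Icc₃ (a₀ := Ua) (a₁ := sa) (a₂ := n₁) (b₀ := Ub) (b₁ := sb) (b₂ := n₂)
    (c₀ := -U₁ * c + U₀ * β₀ + β₁ * s₀ * U₁ - (U₀ - U₁) * c₀) (c₁ := c - β₀ - β₁ * s₀ - (U₀ - U₁) * c₁)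
    (c₂ := β₁ * (U₀ - U₁) - (U₀ - U₁) * c₂) (c₃ := -U₁ * μ + U₀ * β₂ + β₃ * s₀ * U₁ - (U₀ - U₁) * c₃)
    (c₄ := 0 - (U₀ - U₁) * c₄) (c₅ := μ - β₂ - β₃ * s₀ - (U₀ - U₁) * c₅)
    (c₆ := β₃ * (U₀ - U₁) - (U₀ - U₁) * c₆) (c₇ := 0 - (U₀ - U₁) * c₇)
    (by linear_combination v₁₁₁) (by linear_combination v₁₁₂) (by linear_combination v₁₂₁)
    (by linear_combination v₁₂₂) (by linear_combination v₂₁₁) (by linear_combination v₂₁₂)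
    (by linear_combination v₂₂₁) (by linear_combination v₂₂₂) θ hθ
  have h3 : (U₀ - U₁) * (c₀ + c₁ * θ 0 + c₂ * θ 1 + c₃ * θ 2 + c₄ * θ 0 * θ 1 + c₅ * θ 0 * θ 2 +
      c₆ * θ 1 * θ 2 + c₇ * θ 0 * θ 1 * θ 2) ≤ (U₀ - U₁) * energyDensityTT' t (θ 1) (θ 0) (θ 2) := by
    linear_combination h1 + hv
  exact le_of_mul_le_mul_left h3 hD

end Summit.Ventures.CertifiedManyBodySolver.Certificates
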